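import Literature.AnabelianGeometry.EtaleTheta.Discharge.Sec2AutOverProofs
import Literature.AnabelianGeometry.EtaleTheta.Discharge.Sec2GalExtensionProofs
import Literature.AnabelianGeometry.EtaleTheta.TowerOfSetting

/-!
# [EtTh] Prop 2.14 (iii), MONO-theta case, translation part: every `Gal(Y/X)`-conjugation lifts to an
# automorphism of the model mono-theta environment (generic from `hgal`; at the §1 MODEL modulo
# Prop 1.5 (ii), (iii))

Mochizuki, *The Étale Theta Function and its Frobenioid-theoretic Manifestations* [EtTh],
Publ. RIMS 45 (2009), §2, Prop 2.14 (ii)–(iii) pp.49–50 (locator `p.N` = PDF page of the PRIMS text;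
bib key `MochizukiEtTh2009`). PROOF-ONLY companion (no `def`; seat abc-iut-L2-t2, §2 owner) of
`MonoThetaEnv.lean`, of abc-iut-L2-d1's `Discharge/Sec2AutOverProofs.lean`
(`ThetaEnvData.exists_modelIso_of_aut'`) and of abc-iut-L2-t10's `Discharge/Sec2GalExtensionProofs.lean`
(`DoubleUnderline.thetaEnvData_gal_extension` = Prop 2.14 (ii)'s extension of the difference cocycle).

PRINT (Prop 2.14 (iii), p.49–50): "every automorphism of `M` induces an automorphism of `Π^tp_Y`, hence
of the cusps of `Y` … the resulting homomorphism `Aut(M) → (l·ℤ) ⋊ {±1}` is SURJECTIVE" (mono-theta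
case), while for the BI-theta environment the image only contains `(N·l·ℤ) ⋊ {±1}`. Here, the
TRANSLATION part of the mono statement: for EVERY `x ∈ Π^tp_X` (no divisibility condition — contrast
`Discharge/Sec2Prop214iiiTranslationsOfModel.lean`, where the bi-theta environment admits only `x^a`,
`M ∣ a`), the composite of the `Gal(Y/X)`-conjugation `conjX x` with the INVERSE of the Kummer-type
shift `α_ρ` of Prop 2.14 (ii) is an automorphism of the model mono-theta environment `M(η)` inducing
conjugation by `x` on `Π^tp_Y`:

* `ThetaEnvData.exists_monoIso_over_conj_of_galExtension` — generic over the interface, from the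
  `hgal` data (a continuous cocycle `ρ` on `Π^tp_Y` extending `η·(x·η)⁻¹` whose shift normalises `D_Y`);
* `DoubleUnderline.exists_monoIso_over_conj_of_model` / `…_tower` — at abc-iut-L2-t8's §1 model, with
  `hgal` supplied by abc-iut-L2-t10's theorem: conditional on `Prop15iii`, `Prop15ii` (+ the 2-torsion
  clause `H2`, a theorem at every level of a `CyclotomeTower`).

The `{±1}`-part and the cusp-LABEL bookkeeping (`RigidData.ActsOnCuspsBy`) are not addressed (no
inversion automorphism / no label equivariance in the §1 interfaces). HONEST FRAMING: no side is taken
on [IUTchIII] Cor 3.12; typed ≠ discharged elsewhere.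
-/

noncomputable section

namespace Literature.AnabelianGeometry.EtaleTheta

open Literature.AnabelianGeometry.SemiGraphs

universe u

namespace ThetaEnvData

variable {N : ℕ+} (T : ThetaEnvData.{u} N)

/-- Conjugation by an element of `D_Y` preserves `D_Y`. [cite: MochizukiEtTh2009, Def 2.13(i) p.47] -/
theorem map_conj_DY_eq_of_mem {d : TopOut T.env} (hd : d ∈ T.DY) :
    T.DY.map (MulAut.conj d).toMonoidHom = T.DY := by
  ext y
  constructor
  · rintro ⟨z, hz, rfl⟩
    exact T.DY.mul_mem (T.DY.mul_mem hd hz) (T.DY.inv_mem hd)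
  · intro hy
    refine ⟨d⁻¹ * y * d, T.DY.mul_mem (T.DY.mul_mem (T.DY.inv_mem hd) hy) hd, ?_⟩
    change d * (d⁻¹ * y * d) * d⁻¹ = y
    group

/-- If conjugation by `d` preserves `D_Y`, so does conjugation by `d⁻¹`.
[cite: MochizukiEtTh2009, Def 2.13(i) p.47] -/
theorem map_conj_inv_DY_eq {d : TopOut T.env} (hd : T.DY.map (MulAut.conj d).toMonoidHom = T.DY) :
    T.DY.map (MulAut.conj d⁻¹).toMonoidHom = T.DY := by
  conv_lhs => rw [← hd, Subgroup.map_map]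
  have : (MulAut.conj d⁻¹).toMonoidHom.comp (MulAut.conj d).toMonoidHom = MonoidHom.id _ := by
    ext y
    simp
  rw [this, Subgroup.map_id]

/-- **Prop 2.14 (iii), mono case, translation part — from the `hgal` data of Prop 2.14 (ii)**: for
`x ∈ Π^tp_X`, a theta cocycle `η`, and a continuous cocycle `ρ` of `Π^tp_Y` with
`ρ|_{Π^tp_Ÿ} = η · (x·η)⁻¹` whose shift `α_ρ` normalises `D_Y`, the composite `α_ρ⁻¹ ∘ conjX(x)` is an
automorphism of the model mono-theta environment `M(η)`: it normalises `D_Y`, permutes the cyclotome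
(by `χ(aug x)`), and maps `s^Θ_η(k) ↦ s^Θ_η(x k x⁻¹)`. It induces conjugation by `x` on `Π^tp_Y`.
[cite: MochizukiEtTh2009, Prop 2.14(iii) p.50] -/
theorem exists_monoIso_over_conj_of_galExtension {η : T.PiYdd → T.mu} (hη : η ∈ T.thetaCocycles)
    (x : T.PiX) (ρ : T.PiY → T.mu) (hρ : CycEnvelope.IsEnvCocycle T.augY T.chi ρ)
    (hc : CycEnvelope.shift hρ ∈ contMulAut T.env)
    (hρη : ∀ g : T.PiYdd, ρ (T.inclYdd g) = η g * (T.chi (T.aug x) (η ⟨x⁻¹ * g * x, by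
      simpa [mul_assoc] using T.PiYdd_normal.conj_mem _ g.2 x⁻¹⟩))⁻¹)
    (hD : T.DY.map (MulAut.conj (TopOut.mk _ ⟨_, hc⟩)).toMonoidHom = T.DY) :
    ∃ α : (T.modelMono hη).Iso (T.modelMono hη),
      (∀ y, α.e y = (CycEnvelope.shift hρ).symm (T.conjX x y)) ∧
      (∀ y, (((α.e y).right : T.PiY) : T.PiX) = x * (y.right : T.PiX) * x⁻¹) ∧
      ∀ a, α.e (CycEnvelope.inMu T.augY T.chi a) = CycEnvelope.inMu T.augY T.chi (T.chi (T.aug x) a) := by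
  haveI : T.PiYdd.Normal := T.PiYdd_normal
  -- the composite as a bi-continuous automorphism
  let s : contMulAut T.env := ⟨CycEnvelope.shift hρ, hc⟩
  let κ : contMulAut T.env := ⟨T.conjX x, T.conjX_mem_contMulAut x⟩
  let c : contMulAut T.env := s⁻¹ * κ
  have hcapp : ∀ y, (c : MulAut T.env) y = (CycEnvelope.shift hρ).symm (T.conjX x y) := fun y => rfl
  -- [c] normalises `D_Y`
  have hDc : T.DY.map (MulAut.conj (TopOut.mk _ c)).toMonoidHom = T.DY := by
    have hmul : TopOut.mk _ c = (TopOut.mk _ s)⁻¹ * TopOut.mk _ κ := by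
      rw [← map_inv, ← map_mul]
    rw [hmul, map_mul]
    change T.DY.map ((MulAut.conj (TopOut.mk _ s)⁻¹).toMonoidHom.comp
      (MulAut.conj (TopOut.mk _ κ)).toMonoidHom) = T.DY
    rw [← Subgroup.map_map, T.map_conj_DY_eq_of_mem (T.mk_conjX_mem_DY x)]
    exact T.map_conj_inv_DY_eq hD
  -- `c` permutes the cyclotome
  have hone : ρ 1 = 1 := hρ.apply_one
  have hμ : ∀ a : T.mu, (c : MulAut T.env) (CycEnvelope.inMu T.augY T.chi a) =
      CycEnvelope.inMu T.augY T.chi (T.chi (T.aug x) a) := by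
    intro a
    rw [hcapp]
    refine SemidirectProduct.ext ?_ ?_
    · show T.chi (T.aug x) a * (ρ ⟨x * ((1 : T.PiY) : T.PiX) * x⁻¹, _⟩)⁻¹ = T.chi (T.aug x) a
      have h1 : (⟨x * ((1 : T.PiY) : T.PiX) * x⁻¹, T.PiY_normal.conj_mem _ (1 : T.PiY).2 x⟩ : T.PiY) = 1 :=
        Subtype.ext (by simp)
      rw [h1, hone, inv_one, mul_one]
    · apply Subtype.ext
      show x * ((1 : T.PiY) : T.PiX) * x⁻¹ = ((1 : T.PiY) : T.PiX)
      simp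
  have hμ₁ : ∀ a, ∃ b, (c : MulAut T.env) (CycEnvelope.inMu T.augY T.chi a) = CycEnvelope.inMu T.augY T.chi b :=
    fun a => ⟨_, hμ a⟩
  have hμ₂ : ∀ b, ∃ a, (c : MulAut T.env) (CycEnvelope.inMu T.augY T.chi a) = CycEnvelope.inMu T.augY T.chi b :=
    fun b => ⟨(T.chi (T.aug x))⁻¹ b, by rw [hμ, MulAut.apply_inv_self]⟩
  -- `c` maps `s^Θ_η(k)` to `s^Θ_η(x k x⁻¹)`
  have hs1 : ∀ k : T.PiYdd, (c : MulAut T.env) (T.sTheta hη k) =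
      T.sTheta hη ⟨x * (k : T.PiX) * x⁻¹, T.PiYdd_normal.conj_mem _ k.2 x⟩ := by
    intro k
    set k' : T.PiYdd := ⟨x * (k : T.PiX) * x⁻¹, T.PiYdd_normal.conj_mem _ k.2 x⟩ with hk'
    have hback : (⟨x⁻¹ * (k' : T.PiX) * x, by
        simpa [mul_assoc] using T.PiYdd_normal.conj_mem _ k'.2 x⁻¹⟩ : T.PiYdd) = k :=
      Subtype.ext (by simp [hk', mul_assoc])
    have hρk : ρ (T.inclYdd k') = η k' * (T.chi (T.aug x) (η k))⁻¹ := by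
      rw [hρη k', hback]
    rw [hcapp]
    refine SemidirectProduct.ext ?_ ?_
    · show T.chi (T.aug x) (η k)⁻¹ * (ρ ⟨x * ((T.inclYdd k : T.PiY) : T.PiX) * x⁻¹, _⟩)⁻¹ = (η k')⁻¹
      have hpt : (⟨x * ((T.inclYdd k : T.PiY) : T.PiX) * x⁻¹,
          T.PiY_normal.conj_mem _ (T.inclYdd k).2 x⟩ : T.PiY) = T.inclYdd k' := Subtype.ext rfl
      rw [hpt, hρk, map_inv, mul_inv_rev, inv_inv, inv_mul_cancel_left]
    · exact Subtype.ext rfl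
  have hs : (T.sTheta hη).range.map (c : MulAut T.env).toMonoidHom = (T.sTheta hη).range := by
    ext z
    constructor
    · rintro ⟨_, ⟨k, rfl⟩, rfl⟩
      exact ⟨_, (hs1 k).symm⟩
    · rintro ⟨k, rfl⟩
      refine ⟨T.sTheta hη ⟨x⁻¹ * (k : T.PiX) * x, by
        simpa [mul_assoc] using T.PiYdd_normal.conj_mem _ k.2 x⁻¹⟩, ⟨_, rfl⟩, ?_⟩
      rw [MulEquiv.coe_toMonoidHom, hs1]
      congr 1
      exact Subtype.ext (by simp [mul_assoc])
  obtain ⟨α, hα⟩ := T.exists_modelIso_of_aut' hη hη c hDc hμ₁ hμ₂ hs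
  refine ⟨α, fun y => by rw [hα, hcapp], fun y => ?_, fun a => by rw [hα, hμ]⟩
  rw [hα, hcapp]
  rfl

end ThetaEnvData

/-! ## At the §1 model -/

namespace ThetaSetting.EtaleThetaData.DoubleUnderline

variable {p : ℕ} [Fact p.Prime] {D : ThetaSetting p} {E : D.EtaleThetaData} {l : ℕ}
  (C : E.DoubleUnderline l)

/-- **Prop 2.14 (iii), mono case, translation part, AT THE §1 MODEL** (one level `N`, cyclotome
`μ : CyclotomeMod l N`): for EVERY `x ∈ Π^tp_X̲̲` and every theta cocycle `η`, there is an automorphism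
of the model mono-theta environment `M_N(η)` inducing conjugation by `x` on `Π^tp_Y̲̲` and `χ(aug x)` on
`μ_N` — from abc-iut-L2-t10's `hgal` (`thetaEnvData_gal_extension`), i.e. conditional on Prop 1.5
(ii), (iii) and the 2-torsion clause `H2`. [cite: MochizukiEtTh2009, Prop 2.14(iii) p.50] -/
theorem exists_monoIso_over_conj_of_model {N : ℕ+} (μ : D.CyclotomeMod l N) (hC : D.Compat)
    (hS : D.Sec2Hyps) (h15 : Prop15iii E hC) (h15ii : Prop15ii E.toKummerData hC)
    (H2 : ∀ t : D.lDeltaTheta l, t ^ 2 = 1 → μ.red t = 1)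
    {η : (C.thetaEnvData μ hC hS).PiYdd → (C.thetaEnvData μ hC hS).mu}
    (hη : η ∈ (C.thetaEnvData μ hC hS).thetaCocycles) (x : (C.thetaEnvData μ hC hS).PiX) :
    ∃ α : ((C.thetaEnvData μ hC hS).modelMono hη).Iso ((C.thetaEnvData μ hC hS).modelMono hη),
      (∀ y, ((((α.e y).right : (C.thetaEnvData μ hC hS).PiY)) : (C.thetaEnvData μ hC hS).PiX) =
        x * (y.right : (C.thetaEnvData μ hC hS).PiX) * x⁻¹) ∧
      ∀ a, α.e (CycEnvelope.inMu (C.thetaEnvData μ hC hS).augY (C.thetaEnvData μ hC hS).chi a) =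
        CycEnvelope.inMu (C.thetaEnvData μ hC hS).augY (C.thetaEnvData μ hC hS).chi
          ((C.thetaEnvData μ hC hS).chi ((C.thetaEnvData μ hC hS).aug x) a) := by
  obtain ⟨ρ, hρ, hc, hρη, hD⟩ := C.thetaEnvData_gal_extension μ hC hS h15 h15ii H2 η hη x
  obtain ⟨α, -, h2, h3⟩ :=
    (C.thetaEnvData μ hC hS).exists_monoIso_over_conj_of_galExtension hη x ρ hρ hc hρη hD
  exact ⟨α, h2, h3⟩

/-- The same at EVERY LEVEL `M` of the model tower over a `CyclotomeTower` (where `H2` is a theorem,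
`CyclotomeTower.red_eq_one_of_sq_eq_one`): conditional on Prop 1.5 (ii), (iii) ONLY.
[cite: MochizukiEtTh2009, Prop 2.14(iii) p.50] -/
theorem exists_monoIso_over_conj_of_model_tower {Es : Set ℕ+} (τ : D.CyclotomeTower l Es)
    (hC : D.Compat) (hS : D.Sec2Hyps) (h15 : Prop15iii E hC) (h15ii : Prop15ii E.toKummerData hC)
    (M : Es) {η : (C.thetaEnvTower τ hC hS).PiYdd → (C.thetaEnvTower τ hC hS).mu M}
    (hη : η ∈ (C.thetaEnvTower τ hC hS).thetaCocycles M) (x : (C.thetaEnvTower τ hC hS).PiX) :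
    ∃ α : (((C.thetaEnvTower τ hC hS).level M).modelMono hη).Iso
        (((C.thetaEnvTower τ hC hS).level M).modelMono hη),
      (∀ y, ((((α.e y).right : ((C.thetaEnvTower τ hC hS).level M).PiY)) :
          (C.thetaEnvTower τ hC hS).PiX) = x * (y.right : (C.thetaEnvTower τ hC hS).PiX) * x⁻¹) ∧
      ∀ a, α.e (CycEnvelope.inMu ((C.thetaEnvTower τ hC hS).level M).augY
          ((C.thetaEnvTower τ hC hS).level M).chi a) =
        CycEnvelope.inMu ((C.thetaEnvTower τ hC hS).level M).augY ((C.thetaEnvTower τ hC hS).level M).chi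
          ((C.thetaEnvTower τ hC hS).chi M ((C.thetaEnvTower τ hC hS).aug x) a) :=
  C.exists_monoIso_over_conj_of_model (τ.mod M) hC hS h15 h15ii (τ.red_eq_one_of_sq_eq_one M) hη x

end ThetaSetting.EtaleThetaData.DoubleUnderline

end Literature.AnabelianGeometry.EtaleTheta

end
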